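import Mathlib
import HarnessLib
import Summits.HubbardSuperconductivity.HubbardSuperconductivity.Theorems.KLProgrammeH10TwoPointLimitSectorMultiplierSupport
import Summits.HubbardSuperconductivity.HubbardSuperconductivity.Theorems.KLProgrammeKLRegimeFatMultiplierPackThird
import Summits.HubbardSuperconductivity.HubbardSuperconductivity.Theorems.KLProgrammeKLRegimeSymbolIncrementSampled
import Summits.HubbardSuperconductivity.HubbardSuperconductivity.Theorems.KLProgrammeKLRegimeSectorMultiplierFrameDiffData

/-!
# Route `KLProgramme` — VL child `KLRegimeVolumeLimitV17F2` (stmt-HubbardSuperconductivity-20440), closer MODEL file M2 «MISMATCH-SLICE», bracket (c),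
# part 2e-i: the THIN × THIN multiplier pair on TWO FRAMES — the sampled symbol DIFFERENCE `F[K′]_{n₁ω₁}F[K′]_{n₂ω₂} − F[K]_{n₁ω₁}F[K]_{n₂ω₂}`
# (same `L, M, β, μ, e₀`): identification with the two-band symbol difference of part 2d, SUP, SUPPORT COUNT, and pointwise SECOND DIFFERENCES in
# time and along any integer step — every bound carries the frame increment `ε ≥ max_{j≤2} coeffNorm j (K′ ⊖ K)`

Cell `gate-hubbard-kl`, seat hubbard-kl-k3c4-p2 (g11; UV / Matsubara all-U lane), ask «MISMATCH-SLICE» (= M2, bracket (c)) of the VL registrant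
k3c4-p1 g11 (the object is the composite re-sectorisation `T_j[K] − T_j[K″]` on the fine volume; by `…SectorOverlapDefectRows` its plain / pinned
position sums are character sums of the product-symbol difference, and the thin × fat pair is a sum of `≤ 3` thin × thin pairs by
`klAnisoFamily_mul_bgmFatMultiplier_eq_sum` at each frame).  For the thin pair `klAnisoFamily … K e₀ n₁ ω₁ · klAnisoFamily … K e₀ n₂ ω₂` (`n₂ ≤ n₁`)
p4's `klAniso_mul_klAniso_eq_symbol` identifies the product with the sample of `G(k₀² + e_K(p)²)·Z(p)`, `G = G_{n₁}G_{n₂}` (order-three profile data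
`scaleProfile_mul_bounds₃`, scale `Λ = Λ_{n₁}`), `Z` p4's angular factor (frame-FREE).  Hence the difference of the products at two frames `K, K′` of
common `C²` size `A` is the sampled two-band difference of `…SymbolIncrementSampled` with `e₀ = e_K`, `e₁ = e_{K′}` (`E₀ = 4 + A + |μ|`,
`K₁ = 4 + 2A`, `K₂ = 4 + 4A`), increment data `(ε, 2ε, 4ε)` (`frameIncrement_toLp_data`) and `z₀ = 1`:

* §1 **`thinPairDiff_eq_symbolDiff`** (the identification), **`norm_thinPairDiff_le`** (sup `≤ g₁/Λ²·(2E₀·ε·1)`),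
  **`card_support_thinPairDiff_le`** (`≤` twice p4's `card_support_klAnisoPair_le` count — the same closed form at both frames);
* §2 **`norm_fwdDiff_two_time_thinPairDiff_le`** (window `Λβ < π(2M − 3)`: `≤ (4h₂+2h₁)(2π/β)²(2E₀ε)/Λ²`),
  **`norm_fwdDiff_two_space_thinPairDiff_le`** (integer step `u`, `4π|u_j| ≤ zL`: `≤ ‖(2π/L)u‖²·Ξ(ε)` of `norm_fwdDiff_two_space_symbolDiff_le_of_zone`,
  the seam discharged by `frameBand_zone_pos` at both frames and `angularFactor_zone`).

The global `C²` sizes `z₁, z₂` of `Z` are hypotheses (supplied by `exists_angularFactor_derivBounds`; they depend on `(n₁, n₂, ω₁, ω₂, z)` only).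
Everything is proved; no definitions, no named facts. [folklore]  References: BGM 2006 §2.5 Lemma 2.2, §2.7 (2.71a), §3 (3.3).
-/

noncomputable section

namespace Summit.HubbardSuperconductivity.HubbardSuperconductivity.Theorems.TorusFourierL2

set_option linter.dupNamespace false -- summit = problem name (single-conjunct summit), D-0017

open Set Finset Literature.MathematicalPhysics.QuantumLattice Literature.MathematicalPhysics.QuantumLattice.BandSectorCounting
open Literature.MathematicalPhysics.QuantumLattice.FermiRG Literature.Probability.LatticeModels Literature.Analysis.SpecialFunctions
open Summit.HubbardSuperconductivity.HubbardSuperconductivity.Theorems.DispersionFlow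
open Summit.HubbardSuperconductivity.HubbardSuperconductivity.Theorems.KLRegimeSplit
open Summit.HubbardSuperconductivity.HubbardSuperconductivity.Theorems.KLProgrammeLegKernels
open Summit.HubbardSuperconductivity.HubbardSuperconductivity.Theorems.PerturbedFermiCurve
open scoped Real

section ThinPairDiff

variable {L M : ℕ} [NeZero L] [NeZero M] {a b : ℝ} (B : BandBounds a b) {K K' : TrigPolyC4v} {A : ℝ}
  (hA : ∀ p : Momentum, ∀ j ≤ 2, ‖iteratedFDeriv ℝ j (frameShift K) p‖ ≤ A)
  (hA' : ∀ p : Momentum, ∀ j ≤ 2, ‖iteratedFDeriv ℝ j (frameShift K') p‖ ≤ A) (hADt : 2 * A < B.Dtmin)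
  {μ e₀ z β : ℝ} (he : 0 < e₀) (hz : 0 < z) (hz1 : z ≤ 1) (hgap : e₀ + A + z ^ 2 < -μ) (h3 : e₀ + A - μ ≤ 3)
  (hlo : a ≤ μ - A - e₀) (hhi : μ + A + e₀ ≤ b) (hβ : 0 < β) (hρA : 4 * A < 2 * B.rhomin)
  {n₁ n₂ : ℕ} (hn : n₂ ≤ n₁) (ω₁ : Fin (sectorCount n₁)) (ω₂ : Fin (sectorCount n₂))
  {d : ℝ} (hd : 0 ≤ d) (hd1 : ∀ u, |deriv (bgmCutoffSq e₀) u| ≤ d) (hd2 : ∀ u, |iteratedDeriv 2 (bgmCutoffSq e₀) u| ≤ d)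
  (hd3 : ∀ u, |iteratedDeriv 3 (bgmCutoffSq e₀) u| ≤ d)
  {Z : (Fin 2 → ℝ) → ℝ}
  (hZ : ∀ p, Z p = gnCutoff ((π + z) ^ 2 / π ^ 2) ((π + z) ^ 2) (p 0 ^ 2) * gnCutoff ((π + z) ^ 2 / π ^ 2) ((π + z) ^ 2) (p 1 ^ 2) *
    ((radialCutoffC (1 / 2) (momToComplex p) * sectorWeightCirc n₁ ((ω₁ : ℕ) : ℤ) (polarAngle p)) *
      (radialCutoffC (1 / 2) (momToComplex p) * sectorWeightCirc n₂ ((ω₂ : ℕ) : ℤ) (polarAngle p))))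
  {z₁ z₂ : ℝ} (hZ1 : ∀ p, ‖fderiv ℝ Z p‖ ≤ z₁) (hZ2 : ∀ p, ‖iteratedFDeriv ℝ 2 Z p‖ ≤ z₂)
  {ε : ℝ} (hε : ∀ j ≤ 2, (fsub K' K).coeffNorm j ≤ ε)
  {Ds : TorusSite 1 (2 * M) × TorusSite 2 L → ℂ}
  (hDs : ∀ q, Ds q = klAnisoFamily L M β μ K' e₀ n₁ ω₁ (⟨(q.1 0).val, ZMod.val_lt (q.1 0)⟩, q.2) *
      klAnisoFamily L M β μ K' e₀ n₂ ω₂ (⟨(q.1 0).val, ZMod.val_lt (q.1 0)⟩, q.2) -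
    klAnisoFamily L M β μ K e₀ n₁ ω₁ (⟨(q.1 0).val, ZMod.val_lt (q.1 0)⟩, q.2) *
      klAnisoFamily L M β μ K e₀ n₂ ω₂ (⟨(q.1 0).val, ZMod.val_lt (q.1 0)⟩, q.2))

/-! ## §1 Identification, sup, support -/

include hA hA' he hz h3 hZ hDs in
/-- **The thin-pair difference on two frames IS the sampled two-band symbol difference** of `…SymbolIncrementSampled` with the product profile
`G = G_{n₁}G_{n₂}`, bands `e_K, e_{K′}` and p4's angular factor, at the sample `(π(1−2M)/β + (2π/β)·val q₁, (2π/L)·q̃₂)`.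
[cite: BenfattoGiulianiMastropietro2006, §2.5 (2.45)–(2.48)] -/
theorem thinPairDiff_eq_symbolDiff (q : TorusSite 1 (2 * M) × TorusSite 2 L) :
    Ds q =
      (((fun u : ℝ => bgmCutoffSq e₀ ((16 : ℝ) ^ n₁ * u) * bgmCutoffSq e₀ ((16 : ℝ) ^ n₂ * u))
            ((π * (1 - 2 * M) / β + 2 * π / β * (((q.1 0).val : ℕ) : ℝ)) ^ 2 +
              (fun p : Fin 2 → ℝ => frameLevel μ K' (WithLp.toLp 2 p)) (fun j => 2 * π / L * (((q.2 j).valMinAbs : ℤ) : ℝ)) ^ 2) *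
          Z (fun j => 2 * π / L * (((q.2 j).valMinAbs : ℤ) : ℝ)) : ℝ) : ℂ) -
      (((fun u : ℝ => bgmCutoffSq e₀ ((16 : ℝ) ^ n₁ * u) * bgmCutoffSq e₀ ((16 : ℝ) ^ n₂ * u))
            ((π * (1 - 2 * M) / β + 2 * π / β * (((q.1 0).val : ℕ) : ℝ)) ^ 2 +
              (fun p : Fin 2 → ℝ => frameLevel μ K (WithLp.toLp 2 p)) (fun j => 2 * π / L * (((q.2 j).valMinAbs : ℤ) : ℝ)) ^ 2) *
          Z (fun j => 2 * π / L * (((q.2 j).valMinAbs : ℤ) : ℝ)) : ℝ) : ℂ) := by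
  rw [hDs, klAniso_mul_klAniso_eq_symbol hA' he hz h3 ω₁ ω₂ hZ (Φ := fun kp : ℝ × (Fin 2 → ℝ) =>
      ((bgmCutoffSq e₀ ((16 : ℝ) ^ n₁ * (kp.1 ^ 2 + frameLevel μ K' (WithLp.toLp 2 kp.2) ^ 2)) *
        bgmCutoffSq e₀ ((16 : ℝ) ^ n₂ * (kp.1 ^ 2 + frameLevel μ K' (WithLp.toLp 2 kp.2) ^ 2)) * Z kp.2 : ℝ) : ℂ)) (fun _ _ => rfl) q,
    klAniso_mul_klAniso_eq_symbol hA he hz h3 ω₁ ω₂ hZ (Φ := fun kp : ℝ × (Fin 2 → ℝ) =>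
      ((bgmCutoffSq e₀ ((16 : ℝ) ^ n₁ * (kp.1 ^ 2 + frameLevel μ K (WithLp.toLp 2 kp.2) ^ 2)) *
        bgmCutoffSq e₀ ((16 : ℝ) ^ n₂ * (kp.1 ^ 2 + frameLevel μ K (WithLp.toLp 2 kp.2) ^ 2)) * Z kp.2 : ℝ) : ℂ)) (fun _ _ => rfl) q]

include hA hA' he hz h3 hn hd hd1 hd2 hd3 hZ hε hDs in
/-- **SUP of the thin-pair difference**: `‖D(q)‖ ≤ g₁/Λ²·(2E₀·ε·1)` (`g₁ = d e₀²·1 + 1·d e₀²`, `Λ = Λ_{n₁}`, `E₀ = 4 + A + |μ|`; mean value in the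
interpolation parameter, `norm_fwdDiff_iter_symbolIncrement_le` at order `0`). [cite: BenfattoGiulianiMastropietro2006, §3 (3.3)] -/
theorem norm_thinPairDiff_le (q : TorusSite 1 (2 * M) × TorusSite 2 L) :
    ‖Ds q‖ ≤ (d * e₀ ^ 2 * 1 + 1 * (d * e₀ ^ 2)) / klScale e₀ n₁ ^ 2 * (2 * (4 + A + |μ|) * ε * 1) := by
  obtain ⟨hGc, -, hG1, -, -, -⟩ := scaleProfile_mul_bounds₃ he hn hd hd1 hd2 hd3
  have hGd : Differentiable ℝ (fun u : ℝ => bgmCutoffSq e₀ ((16 : ℝ) ^ n₁ * u) * bgmCutoffSq e₀ ((16 : ℝ) ^ n₂ * u)) :=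
    hGc.differentiable (by norm_num)
  obtain ⟨hP₀, -, -⟩ := frameIncrement_toLp_data μ K K' hε
  have hE := abs_frameBand_le hA μ
  have hE' := abs_frameBand_le hA' μ
  have hz0 := abs_angularFactor_le_one hZ
  rw [thinPairDiff_eq_symbolDiff hA hA' he hz h3 ω₁ ω₂ hZ hDs q]
  have key := norm_fwdDiff_iter_symbolIncrement_le hGd (fun p : Fin 2 → ℝ => frameLevel μ K (WithLp.toLp 2 p))
    (fun p : Fin 2 → ℝ => frameLevel μ K' (WithLp.toLp 2 p)) Z
    (fun q : TorusSite 1 (2 * M) × TorusSite 2 L => π * (1 - 2 * M) / β + 2 * π / β * (((q.1 0).val : ℕ) : ℝ))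
    (fun q : TorusSite 1 (2 * M) × TorusSite 2 L => fun j => 2 * π / L * (((q.2 j).valMinAbs : ℤ) : ℝ)) 0 0 q
    (C := (d * e₀ ^ 2 * 1 + 1 * (d * e₀ ^ 2)) / klScale e₀ n₁ ^ 2 * (2 * (4 + A + |μ|) * ε * 1)) ?_
  · simpa only [Function.iterate_zero, id] using key
  intro t ht
  obtain ⟨ht0, ht1⟩ := ht
  simp only [Function.iterate_zero, id]
  rw [Complex.norm_real, Real.norm_eq_abs]
  set k₀ : ℝ := π * (1 - 2 * M) / β + 2 * π / β * (((q.1 0).val : ℕ) : ℝ)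
  set p : Fin 2 → ℝ := fun j => 2 * π / L * (((q.2 j).valMinAbs : ℤ) : ℝ)
  set e0 : ℝ := frameLevel μ K (WithLp.toLp 2 p)
  set e1 : ℝ := frameLevel μ K' (WithLp.toLp 2 p)
  have hg : 0 ≤ (d * e₀ ^ 2 * 1 + 1 * (d * e₀ ^ 2)) / klScale e₀ n₁ ^ 2 := le_trans (abs_nonneg _) (hG1 0)
  have hE0 : 0 ≤ 4 + A + |μ| := le_trans (abs_nonneg _) (hE p)
  have het : |e0 + t * (e1 - e0)| ≤ 4 + A + |μ| := by
    have h1t : 0 ≤ 1 - t := by linarith [ht1.le]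
    calc |e0 + t * (e1 - e0)| = |(1 - t) * e0 + t * e1| := by ring_nf
      _ ≤ |(1 - t) * e0| + |t * e1| := abs_add_le _ _
      _ = (1 - t) * |e0| + t * |e1| := by rw [abs_mul, abs_mul, abs_of_nonneg h1t, abs_of_nonneg ht0]
      _ ≤ (1 - t) * (4 + A + |μ|) + t * (4 + A + |μ|) := by gcongr <;> first | exact hE p | exact hE' p
      _ = 4 + A + |μ| := by ring
  have hv : |e1 - e0| ≤ ε := hP₀ p
  rw [abs_mul, abs_mul, abs_mul, abs_mul, abs_two]
  calc |deriv (fun u : ℝ => bgmCutoffSq e₀ ((16 : ℝ) ^ n₁ * u) * bgmCutoffSq e₀ ((16 : ℝ) ^ n₂ * u)) (k₀ ^ 2 + (e0 + t * (e1 - e0)) ^ 2)| *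
        (2 * |e0 + t * (e1 - e0)| * |e1 - e0|) * |Z p| ≤
      (d * e₀ ^ 2 * 1 + 1 * (d * e₀ ^ 2)) / klScale e₀ n₁ ^ 2 * (2 * (4 + A + |μ|) * ε) * 1 := by
        have hε0 : 0 ≤ ε := le_trans (abs_nonneg _) hv
        refine mul_le_mul (mul_le_mul (hG1 _) (by gcongr) (by positivity) hg) (hz0 p) (abs_nonneg _)
          (mul_nonneg hg (mul_nonneg (mul_nonneg zero_le_two hE0) hε0))
    _ = _ := by ring

include B hA hA' hADt he hz hz1 hgap h3 hlo hhi hβ hρA hn hd hd1 hd2 hZ hDs in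
/-- **SUPPORT COUNT of the thin-pair difference**: `D(q) ≠ 0` forces one of the two products to be non-zero, so `#{D ≠ 0}` is at most TWICE p4's
count `card_support_klAnisoPair_le` (whose closed form depends on `A, Λ_{n₁}, w_{n₂}, β, L` and the band bounds only — the same at both frames).
[cite: BenfattoGiulianiMastropietro2006, §2.5 (2.46)–(2.50)] -/
theorem card_support_thinPairDiff_le [DecidablePred fun q : TorusSite 1 (2 * M) × TorusSite 2 L => Ds q ≠ 0] :
    (((univ : Finset (TorusSite 1 (2 * M) × TorusSite 2 L)).filter fun q => Ds q ≠ 0).card : ℝ) ≤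
      2 * ((klScale e₀ n₁ * β / π + 1) *
        ((Real.sqrt 2 * L * ((klScale e₀ n₁ + (4 + 4 * A) *
            ((klScale e₀ n₁ + B.smax * B.Dtmin * (3 * sectorWidth n₂ / 4)) / (B.Dtmin - 2 * A)) ^ 2) / (2 * B.rhomin - 4 * A)) / π + 2) *
          (Real.sqrt 2 * L * (2 * ((klScale e₀ n₁ + B.smax * B.Dtmin * (3 * sectorWidth n₂ / 4)) / (B.Dtmin - 2 * A))) / π + 2))) := by
  classical
  set G₁ : TorusSite 1 (2 * M) × TorusSite 2 L → ℂ := fun q => klAnisoFamily L M β μ K' e₀ n₁ ω₁ (⟨(q.1 0).val, ZMod.val_lt (q.1 0)⟩, q.2) *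
      klAnisoFamily L M β μ K' e₀ n₂ ω₂ (⟨(q.1 0).val, ZMod.val_lt (q.1 0)⟩, q.2) with hG₁
  set G₀ : TorusSite 1 (2 * M) × TorusSite 2 L → ℂ := fun q => klAnisoFamily L M β μ K e₀ n₁ ω₁ (⟨(q.1 0).val, ZMod.val_lt (q.1 0)⟩, q.2) *
      klAnisoFamily L M β μ K e₀ n₂ ω₂ (⟨(q.1 0).val, ZMod.val_lt (q.1 0)⟩, q.2) with hG₀
  have h1 := card_support_klAnisoPair_le B hA' hADt he hz hz1 hgap h3 hlo hhi hβ hρA hn ω₁ ω₂ hd hd1 hd2 hZ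
    (Φ := fun kp : ℝ × (Fin 2 → ℝ) => ((bgmCutoffSq e₀ ((16 : ℝ) ^ n₁ * (kp.1 ^ 2 + frameLevel μ K' (WithLp.toLp 2 kp.2) ^ 2)) *
      bgmCutoffSq e₀ ((16 : ℝ) ^ n₂ * (kp.1 ^ 2 + frameLevel μ K' (WithLp.toLp 2 kp.2) ^ 2)) * Z kp.2 : ℝ) : ℂ)) (fun _ _ => rfl)
    (Gs := G₁) (fun q => rfl)
  have h0 := card_support_klAnisoPair_le B hA hADt he hz hz1 hgap h3 hlo hhi hβ hρA hn ω₁ ω₂ hd hd1 hd2 hZ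
    (Φ := fun kp : ℝ × (Fin 2 → ℝ) => ((bgmCutoffSq e₀ ((16 : ℝ) ^ n₁ * (kp.1 ^ 2 + frameLevel μ K (WithLp.toLp 2 kp.2) ^ 2)) *
      bgmCutoffSq e₀ ((16 : ℝ) ^ n₂ * (kp.1 ^ 2 + frameLevel μ K (WithLp.toLp 2 kp.2) ^ 2)) * Z kp.2 : ℝ) : ℂ)) (fun _ _ => rfl)
    (Gs := G₀) (fun q => rfl)
  have hsub : ((univ : Finset (TorusSite 1 (2 * M) × TorusSite 2 L)).filter fun q => Ds q ≠ 0) ⊆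
      ((univ.filter fun q => G₁ q ≠ 0) ∪ (univ.filter fun q => G₀ q ≠ 0)) := by
    intro q hq
    simp only [Finset.mem_filter, Finset.mem_univ, true_and, Finset.mem_union] at hq ⊢
    by_contra hnot
    push Not at hnot
    apply hq
    have e1 := hnot.1
    have e0 := hnot.2
    rw [hG₁] at e1
    rw [hG₀] at e0
    simp only at e1 e0
    rw [hDs q, e1, e0, sub_zero]
  have hcard := (Finset.card_le_card hsub).trans (Finset.card_union_le _ _)
  have hcast : (((univ : Finset (TorusSite 1 (2 * M) × TorusSite 2 L)).filter fun q => Ds q ≠ 0).card : ℝ) ≤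
      ((univ.filter fun q => G₁ q ≠ 0).card : ℝ) + ((univ.filter fun q => G₀ q ≠ 0).card : ℝ) := by exact_mod_cast hcard
  linarith

/-! ## §2 Second differences in time and along an integer step -/

include hA hA' he hz h3 hβ hn hd hd1 hd2 hd3 hZ hε hDs in
omit [NeZero L] in
/-- **TIME second differences of the thin-pair difference**: under the window `Λ_{n₁}β < π(2M − 3)`,
`‖Δ²_{(1,0)} D(q)‖ ≤ (4h₂ + 2h₁)(2π/β)²(2E₀·ε·1)/Λ²` (`h₁ = g₂/Λ²`, `h₂ = g₃/Λ²`, the product-profile constants of `scaleProfile_mul_bounds₃`).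
[cite: BenfattoGiulianiMastropietro2006, §2.5 Lemma 2.2 (2.52), (2.56); §3 (3.3)] -/
theorem norm_fwdDiff_two_time_thinPairDiff_le [NeZero L] (hM : klScale e₀ n₁ * β < π * (2 * M - 3))
    (q : TorusSite 1 (2 * M) × TorusSite 2 L) :
    ‖((fwdDiff ((fun _ : Fin 1 => (1 : ZMod (2 * M))), (0 : TorusSite 2 L)))^[2] Ds) q‖ ≤
      (4 * ((d * e₀ ^ 6 * 1 + 3 * (d * e₀ ^ 4) * (d * e₀ ^ 2) + 3 * (d * e₀ ^ 2) * (d * e₀ ^ 4) + 1 * (d * e₀ ^ 6)) / klScale e₀ n₁ ^ 2) +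
          2 * ((d * e₀ ^ 4 * 1 + 2 * (d * e₀ ^ 2) * (d * e₀ ^ 2) + 1 * (d * e₀ ^ 4)) / klScale e₀ n₁ ^ 2)) *
        (2 * π / β) ^ 2 * (2 * (4 + A + |μ|) * ε * 1) / klScale e₀ n₁ ^ 2 := by
  haveI : NeZero (2 * M) := ⟨by have := NeZero.ne M; omega⟩
  obtain ⟨hGc, -, hG1, hG2, hG3, hGv⟩ := scaleProfile_mul_bounds₃ he hn hd hd1 hd2 hd3
  have hΛ : 0 < klScale e₀ n₁ := by rw [klScale]; positivity
  obtain ⟨hP₀, -, -⟩ := frameIncrement_toLp_data μ K K' hε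
  have hfun : Ds = fun q : TorusSite 1 (2 * M) × TorusSite 2 L =>
      (((fun u : ℝ => bgmCutoffSq e₀ ((16 : ℝ) ^ n₁ * u) * bgmCutoffSq e₀ ((16 : ℝ) ^ n₂ * u))
            ((π * (1 - 2 * M) / β + 2 * π / β * (((q.1 0).val : ℕ) : ℝ)) ^ 2 +
              (fun p : Fin 2 → ℝ => frameLevel μ K' (WithLp.toLp 2 p)) (fun j => 2 * π / L * (((q.2 j).valMinAbs : ℤ) : ℝ)) ^ 2) *
          Z (fun j => 2 * π / L * (((q.2 j).valMinAbs : ℤ) : ℝ)) : ℝ) : ℂ) -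
      (((fun u : ℝ => bgmCutoffSq e₀ ((16 : ℝ) ^ n₁ * u) * bgmCutoffSq e₀ ((16 : ℝ) ^ n₂ * u))
            ((π * (1 - 2 * M) / β + 2 * π / β * (((q.1 0).val : ℕ) : ℝ)) ^ 2 +
              (fun p : Fin 2 → ℝ => frameLevel μ K (WithLp.toLp 2 p)) (fun j => 2 * π / L * (((q.2 j).valMinAbs : ℤ) : ℝ)) ^ 2) *
          Z (fun j => 2 * π / L * (((q.2 j).valMinAbs : ℤ) : ℝ)) : ℝ) : ℂ) :=
    funext (thinPairDiff_eq_symbolDiff hA hA' he hz h3 ω₁ ω₂ hZ hDs)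
  rw [hfun]
  exact norm_fwdDiff_two_time_symbolDiff_le hGc hΛ (by positivity) (by positivity) hG1 hG2 hG3 hGv
    (fun p : Fin 2 → ℝ => frameLevel μ K (WithLp.toLp 2 p)) (fun p : Fin 2 → ℝ => frameLevel μ K' (WithLp.toLp 2 p)) Z
    (abs_frameBand_le hA μ) (abs_frameBand_le hA' μ) hP₀ (abs_angularFactor_le_one hZ) (π * (1 - 2 * M) / β) (2 * π / β) (2 * π / L)
    (fun m hm => symbol_window hβ hM m hm) q

include hA hA' he hz hz1 hgap h3 hn hd hd1 hd2 hd3 hZ hZ1 hZ2 hε hDs in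
/-- **SPACE second differences of the thin-pair difference along an integer step `u`** (`w = (2π/L)u`, `4π|u_j| ≤ zL`):
`‖Δ²_{(0,ū)} D(q)‖ ≤ ‖w‖²·Ξ`, `Ξ` the constant of `norm_fwdDiff_two_space_symbolDiff_le_of_zone` with `h₀ = g₁/Λ²`, `h₁ = g₂/Λ²`, `h₂ = g₃/Λ²`
(product profile), `K₁ = 4+2A`, `K₂ = 4+4A`, `E₀ = 4+A+|μ|`, `(P₀,P₁,P₂) = (ε,2ε,4ε)`, `(z₀,z₁,z₂) = (1,z₁,z₂)` — every term carries `ε`.  The seam: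
at a seam momentum some `|p_j| ≥ π − z`; on the strip `|p_j| ≤ π + z` both bands exceed `Λ_{n₁} ≤ e₀` (`frameBand_zone_pos`), beyond it the
angular factor vanishes (`angularFactor_zone`). [cite: BenfattoGiulianiMastropietro2006, §2.5 Lemma 2.2 (2.53)–(2.55); §3 (3.3)] -/
theorem norm_fwdDiff_two_space_thinPairDiff_le (u : Fin 2 → ℤ) (hu : ∀ j, 2 * |2 * π / L| * |(u j : ℝ)| ≤ z)
    (q : TorusSite 1 (2 * M) × TorusSite 2 L) :
    ‖((fwdDiff ((0 : TorusSite 1 (2 * M)), (fun j => ((u j : ℤ) : ZMod L))))^[2] Ds) q‖ ≤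
      ‖(fun j => 2 * π / L * (u j : ℝ))‖ ^ 2 *
        (((4 * ((d * e₀ ^ 6 * 1 + 3 * (d * e₀ ^ 4) * (d * e₀ ^ 2) + 3 * (d * e₀ ^ 2) * (d * e₀ ^ 4) + 1 * (d * e₀ ^ 6)) /
                klScale e₀ n₁ ^ 2) +
              2 * ((d * e₀ ^ 4 * 1 + 2 * (d * e₀ ^ 2) * (d * e₀ ^ 2) + 1 * (d * e₀ ^ 4)) / klScale e₀ n₁ ^ 2)) *
              (4 + 2 * A) ^ 2 / klScale e₀ n₁ ^ 2 +
            2 * ((d * e₀ ^ 4 * 1 + 2 * (d * e₀ ^ 2) * (d * e₀ ^ 2) + 1 * (d * e₀ ^ 4)) / klScale e₀ n₁ ^ 2) * (4 + 4 * A) /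
              klScale e₀ n₁) * (2 * (4 + A + |μ|) * ε * 1) +
          4 * ((d * e₀ ^ 4 * 1 + 2 * (d * e₀ ^ 2) * (d * e₀ ^ 2) + 1 * (d * e₀ ^ 4)) / klScale e₀ n₁ ^ 2) * (4 + 2 * A) /
              klScale e₀ n₁ * (2 * (((4 + 2 * A) * ε + (4 + A + |μ|) * (2 * ε)) * 1 + (4 + A + |μ|) * ε * z₁)) +
          (d * e₀ ^ 2 * 1 + 1 * (d * e₀ ^ 2)) / klScale e₀ n₁ ^ 2 *
            (2 * (((4 + 4 * A) * ε + 2 * (4 + 2 * A) * (2 * ε) + (4 + A + |μ|) * (4 * ε)) * 1 +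
              2 * ((4 + 2 * A) * ε + (4 + A + |μ|) * (2 * ε)) * z₁ + (4 + A + |μ|) * ε * z₂))) := by
  haveI : NeZero (2 * M) := ⟨by have := NeZero.ne M; omega⟩
  obtain ⟨hGc, -, hG1, hG2, hG3, hGv⟩ := scaleProfile_mul_bounds₃ he hn hd hd1 hd2 hd3
  have hΛ : 0 < klScale e₀ n₁ := by rw [klScale]; positivity
  have hΛe : klScale e₀ n₁ ≤ e₀ := klScale_le_e0 he.le n₁
  obtain ⟨hP₀, hP₁, hP₂⟩ := frameIncrement_toLp_data μ K K' hε
  have hfun : Ds = fun q : TorusSite 1 (2 * M) × TorusSite 2 L =>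
      (((fun u : ℝ => bgmCutoffSq e₀ ((16 : ℝ) ^ n₁ * u) * bgmCutoffSq e₀ ((16 : ℝ) ^ n₂ * u))
            ((π * (1 - 2 * M) / β + 2 * π / β * (((q.1 0).val : ℕ) : ℝ)) ^ 2 +
              (fun p : Fin 2 → ℝ => frameLevel μ K' (WithLp.toLp 2 p)) (fun j => 2 * π / L * (((q.2 j).valMinAbs : ℤ) : ℝ)) ^ 2) *
          Z (fun j => 2 * π / L * (((q.2 j).valMinAbs : ℤ) : ℝ)) : ℝ) : ℂ) -
      (((fun u : ℝ => bgmCutoffSq e₀ ((16 : ℝ) ^ n₁ * u) * bgmCutoffSq e₀ ((16 : ℝ) ^ n₂ * u))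
            ((π * (1 - 2 * M) / β + 2 * π / β * (((q.1 0).val : ℕ) : ℝ)) ^ 2 +
              (fun p : Fin 2 → ℝ => frameLevel μ K (WithLp.toLp 2 p)) (fun j => 2 * π / L * (((q.2 j).valMinAbs : ℤ) : ℝ)) ^ 2) *
          Z (fun j => 2 * π / L * (((q.2 j).valMinAbs : ℤ) : ℝ)) : ℝ) : ℂ) :=
    funext (thinPairDiff_eq_symbolDiff hA hA' he hz h3 ω₁ ω₂ hZ hDs)
  -- the seam
  have hzone : ∀ m : Fin 2 → ℤ, (∃ j, (L : ℤ) ≤ 2 * |m j| + 2 * (2 : ℕ) * |u j|) →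
      (klScale e₀ n₁ < (fun p : Fin 2 → ℝ => frameLevel μ K (WithLp.toLp 2 p)) (fun j => 2 * π / L * (m j : ℝ)) ∧
        klScale e₀ n₁ < (fun p : Fin 2 → ℝ => frameLevel μ K' (WithLp.toLp 2 p)) (fun j => 2 * π / L * (m j : ℝ))) ∨
      Z (fun j => 2 * π / L * (m j : ℝ)) = 0 := by
    intro m ⟨j, hj⟩
    have hj' : (L : ℝ) ≤ 2 * |(m j : ℝ)| + 4 * |(u j : ℝ)| := by
      have h1 : ((L : ℤ) : ℝ) ≤ ((2 * |m j| + 2 * (2 : ℕ) * |u j| : ℤ) : ℝ) := by exact_mod_cast hj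
      push_cast at h1
      linarith
    have hpj : π - z ≤ |2 * π / L * (m j : ℝ)| := by
      have hL : (0 : ℝ) < L := Nat.cast_pos.2 (Nat.pos_of_ne_zero (NeZero.ne L))
      have hxL : |2 * π / (L : ℝ)| * L = 2 * π := by rw [abs_of_pos (by positivity)]; field_simp
      rw [abs_mul]
      have h1 : |2 * π / (L : ℝ)| * L ≤ |2 * π / (L : ℝ)| * (2 * |(m j : ℝ)| + 4 * |(u j : ℝ)|) :=
        mul_le_mul_of_nonneg_left hj' (abs_nonneg _)
      have h2 := hu j
      nlinarith [abs_nonneg (2 * π / (L : ℝ)), abs_nonneg (m j : ℝ)]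
    rcases le_or_gt |2 * π / L * (m j : ℝ)| (π + z) with hnear | hfar
    · left
      have hgap' : klScale e₀ n₁ + A + z ^ 2 < -μ := by linarith
      exact ⟨frameBand_zone_pos hA hz1 hgap' hpj hnear, frameBand_zone_pos hA' hz1 hgap' hpj hnear⟩
    · right
      exact angularFactor_zone hZ hz ⟨j, hfar.le⟩
  rw [hfun]
  exact norm_fwdDiff_two_space_symbolDiff_le_of_zone hGc hΛ (by positivity) (by positivity) hG1 hG2 hG3 hGv
    (contDiff_frameBand μ K) (contDiff_frameBand μ K') (contDiff_angularFactor hZ)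
    (abs_frameBand_le hA μ) (abs_frameBand_le hA' μ) (norm_fderiv_frameBand_le hA μ) (norm_fderiv_frameBand_le hA' μ)
    (norm_iteratedFDeriv_two_frameBand_le hA μ) (norm_iteratedFDeriv_two_frameBand_le hA' μ) hP₀ hP₁ hP₂
    (abs_angularFactor_le_one hZ) hZ1 hZ2 (π * (1 - 2 * M) / β) (2 * π / β) (2 * π / L) u hzone q

end ThinPairDiff

end Summit.HubbardSuperconductivity.HubbardSuperconductivity.Theorems.TorusFourierL2

end
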